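import Literature.Analysis.Calculus.JacobiFormula
import Literature.Analysis.Calculus.MatrixFieldDeriv
import Mathlib.Analysis.Calculus.Deriv.Prod
import Mathlib.Analysis.Calculus.Deriv.Mul
import Mathlib.Analysis.Calculus.Deriv.Add

/-!
# `BalabanUV.Beta.D1BFx.LogDetSecondVariation` — road «BF-x» for binder row D1, leaf K-R1 (model level), part 1:
# THE SECOND VARIATION OF `log|det A(t)|` ALONG A `C²` MATRIX CURVE IS THE ONE-LOOP FUNCTIONAL `tr(A⁻¹A″) − tr(A⁻¹A′A⁻¹A′)`

HONEST DEPENDENCY (page 1, mandatory): continuum YM on T⁴ ⇐ BetaPertH ∧ nine spine estimates (0/9 proved); BetaPertH ⇐ (D1) ∧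
(D4) ∧ CAP+tail; G-an2-4 gates asym, D1 and NE2/3/4.  HONEST FRAMING (cell contract, verbatim): «discharging `BetaPertH` makes
Bałaban's UV stability UNCONDITIONAL — a real constructive-QFT result; it is NOT the continuum limit and NOT the Clay problem.»
THIS MODULE DISCHARGES NOTHING of the wall: [folklore] finite-dimensional calculus (Jacobi's formula differentiated once more),
the calculus half of the model-level slice transfer K-R1 (skeleton `HOME/beta/skeletons/D1-b2b-balaban-beta-d1-p2.md` v1.5, node R,
leaf R1; `OWNER-RULINGS-1.md` R-1/R-4 (v)).  No `def … : Prop`, no cited fact used as hypothesis, 0 sorry; 0 wall binders touched;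
NOT D1, NOT BetaPertH, NOT continuum, NOT Clay.

ABSOLUTE RULE (cell charter, verbatim): «No internally-minted statement may enter as a cited fact. Every hypothesis is either
kernel-proved in this package or a verbatim quotation of a PUBLISHED theorem with page reference. The manuscript(s) under audit are NOT
citable for their own disputed steps — they are the thing under adjudication; programme-internal (2001/route/tribunal) claims are never
citable.»

WHY.  The typed one-loop step kernel of the cell is `hessKer K V W = ½·tadpole K W − ½·bubble K V V` (`Beta.ExpKernelCalculus` §5), i.e.
ONE HALF of the second variation `tr(A⁻¹A″) − tr(A⁻¹A′A⁻¹A′)` of `log|det A|` along the background, read entrywise.  The slice-transfer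
identities of `Beta.GaugeFixing` ((L1) weight ≡ constraint `det_kkt_add_weight`, (L2) slice change `det_kkt_fromRows_slice_change` with the
squares of the linearised Faddeev–Popov determinants) are identities between DETERMINANTS of bordered matrices, valid for every value
of the background.  Part 2 (`SliceTransferModel`) differentiates them twice; this part supplies the rule: for a matrix curve `A` with
first derivative `A₁` near `t` and second derivative `A₂` at `t`, `det A(t) ≠ 0`,
  `(log|det A|)′ = tr(A⁻¹A₁)` near `t` (tree: `JacobiFormula.hasDerivAt_det_eq_det_mul_trace`, logarithm),
  `(tr(A⁻¹A₁))′(t) = tr(A⁻¹A₂) − tr(A⁻¹A₁A⁻¹A₁)` (tree: `MatrixFieldDeriv.hasFDerivAt_inv_apply`, product rule),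
and the uniqueness corollary used downstream: if `log|det A| = log|det B| + c` near `t` for two such curves, their one-loop functionals
`secondVar` coincide at `t`.

CONTENT (all [folklore]; `ι` finite, curves `ℝ → ι → ι → ℝ` read as matrices through `Matrix.of`, as in `MatrixFieldDeriv`):
* `secondVar A₀ A₁ A₂ := tr(A₀⁻¹A₂) − tr(A₀⁻¹A₁A₀⁻¹A₁)` — the one-loop functional of a 2-jet (twice `hessKer`'s normalisation).
* `hasDerivAt_inv_entry` — curve form of the derivative of the inverse, `((A⁻¹)ₖₗ)′ = −(A⁻¹A₁A⁻¹)ₖₗ`.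
* `hasDerivAt_logAbsDet` — `(log|det A|)′(t) = tr(A(t)⁻¹A₁)` for `det A(t) ≠ 0` (either sign).
* `hasDerivAt_trace_inv_mul` — `(u ↦ tr(A(u)⁻¹·A₁(u)))′(t) = secondVar (A t) (A₁ t) A₂`.
* `secondVar_eq_of_logAbsDet_eq` — UNIQUENESS: two `C²` curves whose `log|det|` differ by a constant near `t` have the same `secondVar` at `t`;
  `secondVar_comb_eq_zero` — the same for a constant LINEAR COMBINATION of four `log|det|`'s (three sizes), the shape of part 2.
-/

noncomputable section

namespace Summit.QuantumFields.BalabanUV.Beta.D1BFx.LogDetSecondVariation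

open Matrix Filter Finset
open scoped Topology
open Literature.Analysis.Calculus (hasDerivAt_det_eq_det_mul_trace differentiableAt_inv_apply fderiv_inv_apply
  eventually_det_ne_zero)

variable {ι : Type*} [Fintype ι] [DecidableEq ι]

/-- [our object] **THE ONE-LOOP FUNCTIONAL OF A 2-JET** `(A₀, A₁, A₂)`: `secondVar A₀ A₁ A₂ := tr(A₀⁻¹A₂) − tr(A₀⁻¹A₁A₀⁻¹A₁)` —
the second variation of `log|det|`, i.e. `2·(½·tadpole − ½·bubble)` in `Beta.ExpKernelCalculus`'s normalisation. -/
def secondVar (A₀ A₁ A₂ : Matrix ι ι ℝ) : ℝ :=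
  (A₀⁻¹ * A₂).trace - (A₀⁻¹ * A₁ * (A₀⁻¹ * A₁)).trace

/-- [folklore] Curve form of the derivative of the inverse matrix (from `MatrixFieldDeriv.hasFDerivAt_inv_apply`): if the curve `A`
has derivative `A₁` at `t` and `det A(t) ≠ 0` then `u ↦ (A(u)⁻¹)ₖₗ` has derivative `−(A(t)⁻¹·A₁·A(t)⁻¹)ₖₗ` at `t`. -/
theorem hasDerivAt_inv_entry {A : ℝ → ι → ι → ℝ} {A₁ : Matrix ι ι ℝ} {t : ℝ}
    (hA : HasDerivAt A (A₁ : ι → ι → ℝ) t) (hdet : (Matrix.of (A t)).det ≠ 0) (k l : ι) :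
    HasDerivAt (fun u => (Matrix.of (A u))⁻¹ k l) (-((Matrix.of (A t))⁻¹ * A₁ * (Matrix.of (A t))⁻¹) k l) t := by
  have hd : DifferentiableAt ℝ (fun u => (Matrix.of (A u))⁻¹ k l) t :=
    differentiableAt_inv_apply hA.hasFDerivAt hdet k l
  have h := hd.hasDerivAt
  have hval : deriv (fun u => (Matrix.of (A u))⁻¹ k l) t = -((Matrix.of (A t))⁻¹ * A₁ * (Matrix.of (A t))⁻¹) k l := by
    have h1 := fderiv_inv_apply hA.hasFDerivAt hdet k l (1 : ℝ)
    rw [show deriv (fun u => (Matrix.of (A u))⁻¹ k l) t = fderiv ℝ (fun u => (Matrix.of (A u))⁻¹ k l) t 1 from rfl, h1]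
    simp only [ContinuousLinearMap.toSpanSingleton_apply, one_smul]
    rfl
  rw [hval] at h
  exact h

/-- [folklore] **JACOBI, logarithmic, either sign**: `(log|det A|)′(t) = tr(A(t)⁻¹·A₁)` whenever `det A(t) ≠ 0`
(`Real.log x = Real.log |x|`). -/
theorem hasDerivAt_logAbsDet {A : ℝ → ι → ι → ℝ} {A₁ : Matrix ι ι ℝ} {t : ℝ}
    (hA : HasDerivAt A (A₁ : ι → ι → ℝ) t) (hdet : (Matrix.of (A t)).det ≠ 0) :
    HasDerivAt (fun u => Real.log |(Matrix.of (A u)).det|) (((Matrix.of (A t))⁻¹ * A₁).trace) t := by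
  have h := (hasDerivAt_det_eq_det_mul_trace hA (isUnit_iff_ne_zero.2 hdet)).log hdet
  have h' : HasDerivAt (fun u => Real.log (Matrix.of (A u)).det) (((Matrix.of (A t))⁻¹ * A₁).trace) t := by
    convert h using 1
    field_simp
  refine h'.congr_of_eventuallyEq ?_
  exact Filter.Eventually.of_forall fun u => (Real.log_abs _)

/-- [folklore] **THE SECOND VARIATION**: if `A` has derivative `A₁(u)` at every `u` near `t`, `A₁` has derivative `A₂` at `t`, and
`det A(t) ≠ 0`, then `u ↦ tr(A(u)⁻¹·A₁(u))` has derivative `secondVar (A t) (A₁ t) A₂ = tr(A⁻¹A₂) − tr(A⁻¹A₁A⁻¹A₁)` at `t`. -/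
theorem hasDerivAt_trace_inv_mul {A A₁ : ℝ → ι → ι → ℝ} {A₂ : Matrix ι ι ℝ} {t : ℝ}
    (hA : HasDerivAt A (A₁ t) t) (hA₁ : HasDerivAt A₁ (A₂ : ι → ι → ℝ) t) (hdet : (Matrix.of (A t)).det ≠ 0) :
    HasDerivAt (fun u => ((Matrix.of (A u))⁻¹ * Matrix.of (A₁ u)).trace)
      (secondVar (Matrix.of (A t)) (Matrix.of (A₁ t)) A₂) t := by
  -- entrywise derivatives
  have hinv : ∀ k l, HasDerivAt (fun u => (Matrix.of (A u))⁻¹ k l)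
      (-((Matrix.of (A t))⁻¹ * Matrix.of (A₁ t) * (Matrix.of (A t))⁻¹) k l) t :=
    fun k l => hasDerivAt_inv_entry (A₁ := Matrix.of (A₁ t)) hA hdet k l
  have hA₁e : ∀ l k, HasDerivAt (fun u => A₁ u l k) (A₂ l k) t := by
    intro l k
    have h1 := (hasDerivAt_pi.1 hA₁) l
    exact (hasDerivAt_pi.1 h1) k
  -- the trace as a finite double sum of products
  have htr : ∀ u, ((Matrix.of (A u))⁻¹ * Matrix.of (A₁ u)).trace = ∑ k, ∑ l, (Matrix.of (A u))⁻¹ k l * A₁ u l k := by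
    intro u
    simp only [Matrix.trace, Matrix.diag, Matrix.mul_apply, Matrix.of_apply]
  have hsum : HasDerivAt (fun u => ∑ k, ∑ l, (Matrix.of (A u))⁻¹ k l * A₁ u l k)
      (∑ k, ∑ l, (-((Matrix.of (A t))⁻¹ * Matrix.of (A₁ t) * (Matrix.of (A t))⁻¹) k l * A₁ t l k
        + (Matrix.of (A t))⁻¹ k l * A₂ l k)) t := by
    refine HasDerivAt.fun_sum fun k _ => HasDerivAt.fun_sum fun l _ => ?_
    exact (hinv k l).mul (hA₁e l k)
  have hfun : (fun u => ((Matrix.of (A u))⁻¹ * Matrix.of (A₁ u)).trace) =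
      fun u => ∑ k, ∑ l, (Matrix.of (A u))⁻¹ k l * A₁ u l k := funext htr
  rw [hfun]
  convert hsum using 1
  -- value bookkeeping: `tr(A⁻¹A₂) − tr((A⁻¹A₁A⁻¹)A₁)` entrywise
  simp only [secondVar, ← Matrix.mul_assoc]
  simp only [Matrix.trace, Matrix.diag, Matrix.mul_apply, Matrix.of_apply, Finset.sum_add_distrib, neg_mul,
    Finset.sum_neg_distrib]
  ring

/-- [folklore] **UNIQUENESS OF THE SECOND VARIATION**: two matrix curves `A`, `B`, each with first derivatives near `t` and a
second derivative at `t`, nondegenerate at `t`, whose `log|det|` differ by a CONSTANT on a neighbourhood of `t`, have the same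
one-loop functional at `t`: `secondVar (A t) (A₁ t) A₂ = secondVar (B t) (B₁ t) B₂`. -/
theorem secondVar_eq_of_logAbsDet_eq {A A₁ B B₁ : ℝ → ι → ι → ℝ} {A₂ B₂ : Matrix ι ι ℝ} {t c : ℝ}
    (hA : ∀ᶠ u in 𝓝 t, HasDerivAt A (A₁ u) u) (hA₁ : HasDerivAt A₁ (A₂ : ι → ι → ℝ) t) (hdA : (Matrix.of (A t)).det ≠ 0)
    (hB : ∀ᶠ u in 𝓝 t, HasDerivAt B (B₁ u) u) (hB₁ : HasDerivAt B₁ (B₂ : ι → ι → ℝ) t) (hdB : (Matrix.of (B t)).det ≠ 0)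
    (heq : ∀ᶠ u in 𝓝 t, Real.log |(Matrix.of (A u)).det| = Real.log |(Matrix.of (B u)).det| + c) :
    secondVar (Matrix.of (A t)) (Matrix.of (A₁ t)) A₂ = secondVar (Matrix.of (B t)) (Matrix.of (B₁ t)) B₂ := by
  -- nondegeneracy near `t`
  have hAt : HasDerivAt A (A₁ t) t := hA.self_of_nhds
  have hBt : HasDerivAt B (B₁ t) t := hB.self_of_nhds
  have hdA' : ∀ᶠ u in 𝓝 t, (Matrix.of (A u)).det ≠ 0 := eventually_det_ne_zero hAt.hasFDerivAt hdA
  have hdB' : ∀ᶠ u in 𝓝 t, (Matrix.of (B u)).det ≠ 0 := eventually_det_ne_zero hBt.hasFDerivAt hdB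
  -- first derivatives near `t`: the difference of the traces vanishes near `t`
  have hfirst : ∀ᶠ u in 𝓝 t, ((Matrix.of (A u))⁻¹ * Matrix.of (A₁ u)).trace = ((Matrix.of (B u))⁻¹ * Matrix.of (B₁ u)).trace := by
    have hev : ∀ᶠ u in 𝓝 t, ∀ᶠ v in 𝓝 u, Real.log |(Matrix.of (A v)).det| = Real.log |(Matrix.of (B v)).det| + c :=
      heq.eventually_nhds
    filter_upwards [hA, hB, hdA', hdB', hev] with u huA huB hduA hduB hequ
    have h1 : HasDerivAt (fun v => Real.log |(Matrix.of (A v)).det|) (((Matrix.of (A u))⁻¹ * Matrix.of (A₁ u)).trace) u :=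
      hasDerivAt_logAbsDet (A₁ := Matrix.of (A₁ u)) huA hduA
    have h2 : HasDerivAt (fun v => Real.log |(Matrix.of (B v)).det| + c) (((Matrix.of (B u))⁻¹ * Matrix.of (B₁ u)).trace) u :=
      (hasDerivAt_logAbsDet (A₁ := Matrix.of (B₁ u)) huB hduB).add_const c
    exact h1.unique (h2.congr_of_eventuallyEq hequ)
  -- differentiate once more at `t`
  have h2A := hasDerivAt_trace_inv_mul hAt hA₁ hdA
  have h2B := hasDerivAt_trace_inv_mul hBt hB₁ hdB
  exact h2A.unique (h2B.congr_of_eventuallyEq hfirst)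

/-- [folklore] **UNIQUENESS, LINEAR-COMBINATION FORM** (the shape in which the slice-transfer identities of `Beta.GaugeFixing` are
differentiated: four bordered/Gram determinants of three different sizes).  Four matrix curves `A B C D`, each with first derivatives
near `t`, a second derivative at `t` and `det ≠ 0` at `t`; if `a·log|det A| + b·log|det B| + c·log|det C| + d·log|det D|` is CONSTANT
near `t`, then `a·secondVar A + b·secondVar B + c·secondVar C + d·secondVar D = 0` at `t`. -/
theorem secondVar_comb_eq_zero {ι₁ ι₂ ι₃ ι₄ : Type*} [Fintype ι₁] [DecidableEq ι₁] [Fintype ι₂] [DecidableEq ι₂]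
    [Fintype ι₃] [DecidableEq ι₃] [Fintype ι₄] [DecidableEq ι₄]
    {A A₁ : ℝ → ι₁ → ι₁ → ℝ} {A₂ : Matrix ι₁ ι₁ ℝ} {B B₁ : ℝ → ι₂ → ι₂ → ℝ} {B₂ : Matrix ι₂ ι₂ ℝ}
    {C C₁ : ℝ → ι₃ → ι₃ → ℝ} {C₂ : Matrix ι₃ ι₃ ℝ} {D D₁ : ℝ → ι₄ → ι₄ → ℝ} {D₂ : Matrix ι₄ ι₄ ℝ} {t a b c d k : ℝ}
    (hA : ∀ᶠ u in 𝓝 t, HasDerivAt A (A₁ u) u) (hA₁ : HasDerivAt A₁ (A₂ : ι₁ → ι₁ → ℝ) t) (hdA : (Matrix.of (A t)).det ≠ 0)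
    (hB : ∀ᶠ u in 𝓝 t, HasDerivAt B (B₁ u) u) (hB₁ : HasDerivAt B₁ (B₂ : ι₂ → ι₂ → ℝ) t) (hdB : (Matrix.of (B t)).det ≠ 0)
    (hC : ∀ᶠ u in 𝓝 t, HasDerivAt C (C₁ u) u) (hC₁ : HasDerivAt C₁ (C₂ : ι₃ → ι₃ → ℝ) t) (hdC : (Matrix.of (C t)).det ≠ 0)
    (hD : ∀ᶠ u in 𝓝 t, HasDerivAt D (D₁ u) u) (hD₁ : HasDerivAt D₁ (D₂ : ι₄ → ι₄ → ℝ) t) (hdD : (Matrix.of (D t)).det ≠ 0)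
    (heq : ∀ᶠ u in 𝓝 t, a * Real.log |(Matrix.of (A u)).det| + b * Real.log |(Matrix.of (B u)).det|
      + c * Real.log |(Matrix.of (C u)).det| + d * Real.log |(Matrix.of (D u)).det| = k) :
    a * secondVar (Matrix.of (A t)) (Matrix.of (A₁ t)) A₂ + b * secondVar (Matrix.of (B t)) (Matrix.of (B₁ t)) B₂
      + c * secondVar (Matrix.of (C t)) (Matrix.of (C₁ t)) C₂ + d * secondVar (Matrix.of (D t)) (Matrix.of (D₁ t)) D₂ = 0 := by
  have hAt : HasDerivAt A (A₁ t) t := hA.self_of_nhds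
  have hBt : HasDerivAt B (B₁ t) t := hB.self_of_nhds
  have hCt : HasDerivAt C (C₁ t) t := hC.self_of_nhds
  have hDt : HasDerivAt D (D₁ t) t := hD.self_of_nhds
  have hdA' : ∀ᶠ u in 𝓝 t, (Matrix.of (A u)).det ≠ 0 := eventually_det_ne_zero hAt.hasFDerivAt hdA
  have hdB' : ∀ᶠ u in 𝓝 t, (Matrix.of (B u)).det ≠ 0 := eventually_det_ne_zero hBt.hasFDerivAt hdB
  have hdC' : ∀ᶠ u in 𝓝 t, (Matrix.of (C u)).det ≠ 0 := eventually_det_ne_zero hCt.hasFDerivAt hdC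
  have hdD' : ∀ᶠ u in 𝓝 t, (Matrix.of (D u)).det ≠ 0 := eventually_det_ne_zero hDt.hasFDerivAt hdD
  -- the combination of first variations vanishes near `t`
  set g : ℝ → ℝ := fun u => a * ((Matrix.of (A u))⁻¹ * Matrix.of (A₁ u)).trace + b * ((Matrix.of (B u))⁻¹ * Matrix.of (B₁ u)).trace
    + c * ((Matrix.of (C u))⁻¹ * Matrix.of (C₁ u)).trace + d * ((Matrix.of (D u))⁻¹ * Matrix.of (D₁ u)).trace with hg
  have hfirst : ∀ᶠ u in 𝓝 t, g u = 0 := by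
    have hev : ∀ᶠ u in 𝓝 t, ∀ᶠ v in 𝓝 u, a * Real.log |(Matrix.of (A v)).det| + b * Real.log |(Matrix.of (B v)).det|
        + c * Real.log |(Matrix.of (C v)).det| + d * Real.log |(Matrix.of (D v)).det| = k := heq.eventually_nhds
    filter_upwards [hA, hB, hC, hD, hdA', hdB', hdC', hdD', hev] with u huA huB huC huD hduA hduB hduC hduD hequ
    have h1 := ((((hasDerivAt_logAbsDet (A₁ := Matrix.of (A₁ u)) huA hduA).const_mul a).add
      ((hasDerivAt_logAbsDet (A₁ := Matrix.of (B₁ u)) huB hduB).const_mul b)).add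
      ((hasDerivAt_logAbsDet (A₁ := Matrix.of (C₁ u)) huC hduC).const_mul c)).add
      ((hasDerivAt_logAbsDet (A₁ := Matrix.of (D₁ u)) huD hduD).const_mul d)
    have h2 : HasDerivAt (fun v => a * Real.log |(Matrix.of (A v)).det| + b * Real.log |(Matrix.of (B v)).det|
        + c * Real.log |(Matrix.of (C v)).det| + d * Real.log |(Matrix.of (D v)).det|) 0 u :=
      (hasDerivAt_const u k).congr_of_eventuallyEq hequ
    have h3 := h1.unique h2
    rw [hg]
    exact h3
  -- differentiate once more at `t`
  have hsecond : HasDerivAt g (a * secondVar (Matrix.of (A t)) (Matrix.of (A₁ t)) A₂ + b * secondVar (Matrix.of (B t)) (Matrix.of (B₁ t)) B₂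
      + c * secondVar (Matrix.of (C t)) (Matrix.of (C₁ t)) C₂ + d * secondVar (Matrix.of (D t)) (Matrix.of (D₁ t)) D₂) t := by
    rw [hg]
    exact ((((hasDerivAt_trace_inv_mul hAt hA₁ hdA).const_mul a).add ((hasDerivAt_trace_inv_mul hBt hB₁ hdB).const_mul b)).add
      ((hasDerivAt_trace_inv_mul hCt hC₁ hdC).const_mul c)).add ((hasDerivAt_trace_inv_mul hDt hD₁ hdD).const_mul d)
  have hzero : HasDerivAt g 0 t := (hasDerivAt_const t (0 : ℝ)).congr_of_eventuallyEq hfirst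
  exact hsecond.unique hzero

end Summit.QuantumFields.BalabanUV.Beta.D1BFx.LogDetSecondVariation
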